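import Literature.AlgebraicGeometry.GroupSchemes.GroupObjectBudsFromCoordinates          -- ★ p845002 (P2): bud axioms of a layer in the points currency
import Literature.AlgebraicGeometry.GroupSchemes.GroupObjectAssociativityFromCoordinates -- ★ (P3, B-p12): `natCast_le_order_assocDefect`; brings ★ p844980 (P1)
import Literature.AlgebraicGeometry.GroupSchemes.BTGroupNilpotentPoints                  -- ★ p844872: `IsRingActionBT` (+ ★ `BTGroup`, `BTGroup.Hom`)
import Literature.RingTheory.FormalGroups.FormalOModuleLawOfTower                        -- (P4a): `exists_formalOModuleLaw_of_tower`
import HarnessLib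

/-!
# The formal `𝒪`-module law of a BT group with natural one-parameter coordinates

Topic `Literature/AlgebraicGeometry/GroupSchemes`; namespace `Literature.AlgebraicGeometry.GroupSchemes`.  Cell `hodgecm-mathlib`,
P6 «MOD programme», sub-line `F0_P6d_ConnectedBTDictionary` stub `HLD` («connected `p`-divisible groups of dimension one ↔ formal
`𝒪`-module laws», [Tate1967, §2.2 Prop. 1], [Messing1972, Ch. II (3.3.18)]), σ1 step (P4b).  THEOREMS ONLY (kernel lane), no
`def`, no instance, no notation, no `sorry`.

SETTING.  `k` a reduced commutative ring, `B : BTGroup (Spec k) p H` (`2 ≤ p`, `0 < H`), NATURAL COORDINATES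
`c n R : (Spec R → B.G n over Spec k) ≃ {x : R // x ^ (p ^ (n H)) = 0}` (naturality clause `hnat`, transition clause `hincl`, as
produced by ★ `BTGroup.exists_coordinates_of_isConnectedDimOne`), and a ring action `β : 𝒪 → End B` (`IsRingActionBT B β`).

WHAT IS HERE.
* §1 box congruence of nilpotent evaluation: `evalNilp₂_congr_of_coeff_box_eq`, `evalNilp_congr_of_coeff_eq`;
* §2 **`BTGroup.exists_formalOModuleLaw_of_coordinates`**: there are a ring homomorphism `χ : 𝒪 →+* k` (the tangent character)
  and, for the algebra structure `χ.toAlgebra`, a formal `𝒪`-module law `M` over `k` such that IN THE COORDINATES `c`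
  the group law of every layer is `M` and the action of every `β a` is `[a]_M`:
  `c (f·g) = M(c f, c g)` and `c (f ≫ β a) = [a]_M (c f)` (nilpotent evaluation).
  Proof: per layer, ★ (P1) `exists_series_of_mul` ∕ `exists_series_of_endomorphism` give series `Pₙ`, `ρₙ a`; ★ (P2) and ★ (P3)
  give the bud axioms modulo the box `p^{nH}`; ★ `coeff_law_eq_of_hom` ∕ `coeff_endo_eq_of_hom` along `B.incl n` give the
  tower compatibilities; (P4a) `exists_formalOModuleLaw_of_tower` gives `χ` and `M` agreeing with `Pₙ`, `ρₙ a` on every box,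
  and §1 turns box agreement into equality of nilpotent evaluations.
CONSUMER: with ★ `BTGroup.exists_coordinates_of_isConnectedDimOne` (S) before and ★
`BTGroup.exists_isPTorsionOfOLawVia_of_coordinates` (P5) after, this is letter (HL-D) `ConnectedDimOneIsOModuleLaw`
(`Theorems/F0P6dStubHLD`).  HC_CM is proved only modulo the printed citations until rung 0 closes; nothing here is about HC.
-/

open AlgebraicGeometry CategoryTheory MonObj CartesianMonoidalCategory
open Literature.RingTheory.FormalGroups

namespace Literature.AlgebraicGeometry.GroupSchemes

universe u v

/-! ## §1 Box congruence of nilpotent evaluation -/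

section Box

variable {A : Type u} [CommRing A] {R : Type v} [CommRing R] [Algebra A R]

/-- If two bivariate series agree on the box `{d : d₀ < N, d₁ < N}` then their nilpotent evaluations at points with
`x^N = y^N = 0` agree. [cite: BourbakiAlgebraII2003, Ch. IV §4 no. 3] -/
theorem evalNilp₂_congr_of_coeff_box_eq {F G : MvPowerSeries (Fin 2) A} {N : ℕ}
    (h : ∀ d : Fin 2 →₀ ℕ, d 0 < N → d 1 < N → MvPowerSeries.coeff d F = MvPowerSeries.coeff d G)
    {x y : R} (hx : x ^ N = 0) (hy : y ^ N = 0) : evalNilp₂ F x y = evalNilp₂ G x y := by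
  rw [evalNilp₂_eq_sum F hx hy, evalNilp₂_eq_sum G hx hy]
  refine Finset.sum_congr rfl fun i hi => Finset.sum_congr rfl fun j hj => ?_
  rw [h _ (by simpa using Finset.mem_range.mp hi) (by simpa using Finset.mem_range.mp hj)]

/-- If two univariate series agree in degrees `< N` then their nilpotent evaluations at a point with `x^N = 0` agree.
[cite: BourbakiAlgebraII2003, Ch. IV §4 no. 3] -/
theorem evalNilp_congr_of_coeff_eq {f g : PowerSeries A} {N : ℕ}
    (h : ∀ i < N, PowerSeries.coeff i f = PowerSeries.coeff i g) {x : R} (hx : x ^ N = 0) :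
    evalNilp f x = evalNilp g x := by
  rw [evalNilp_eq_sum f hx, evalNilp_eq_sum g hx]
  exact Finset.sum_congr rfl fun i hi => by rw [h i (Finset.mem_range.mp hi)]

end Box

/-! ## §2 The formal `𝒪`-module law of a BT group with natural coordinates -/

section Law

variable {k : Type u} [CommRing k] [IsReduced k] {p H : ℕ} (B : BTGroup (Spec (.of k)) p H)
  (c : ∀ (n : ℕ) (R : Type u) [CommRing R] [Algebra k R], (specOver (A := k) R ⟶ B.G n) ≃ {x : R // x ^ (p ^ (n * H)) = 0})

/-- Box sizes of a BT tower: `2 ≤ p^{1·H}` and `2·p^{nH} ≤ p^{(n+1)H}` for `2 ≤ p`, `0 < H`. [cite: Tate1967, §2.2] -/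
private theorem box_sizes (hp : 2 ≤ p) (hH : 0 < H) :
    2 ≤ p ^ (1 * H) ∧ ∀ n, 2 * p ^ (n * H) ≤ p ^ ((n + 1) * H) := by
  have hpH : 2 ≤ p ^ H := le_trans hp (Nat.le_self_pow hH.ne' p)
  refine ⟨by rwa [Nat.one_mul], fun n => ?_⟩
  have e : p ^ ((n + 1) * H) = p ^ (n * H) * p ^ H := by rw [Nat.add_one_mul, pow_add]
  rw [e, Nat.mul_comm 2]
  exact Nat.mul_le_mul_left _ hpH

/-- **THE FORMAL `𝒪`-MODULE LAW OF A BT GROUP WITH NATURAL ONE-PARAMETER COORDINATES** [Tate1967, §2.2 Prop. 1, the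
direction «connected `p`-divisible group ⇒ formal group», with `𝒪`-action].  Over a reduced ring `k`, let `B` be a BT group
(`2 ≤ p`, `0 < H`) with natural coordinates `c n : B.G n (R) ≃ {x ∈ R ∣ x^{p^{nH}} = 0}` (natural in `R`, compatible with the
transitions `incl`), and let `β : 𝒪 → End B` be a ring action.  Then there are a ring homomorphism `χ : 𝒪 →+* k` and, for the
algebra structure `χ`, a formal `𝒪`-module law `M` over `k` such that, in the coordinates `c`, the group law of EVERY layer
is `M` and EVERY `β a` acts as `[a]_M`: `c (f·g) = M(c f, c g)`, `c (f ≫ β a) = [a]_M (c f)`.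
[cite: Tate1967, §2.2 Prop. 1] [cite: Messing1972, Ch. II (3.3.18)] [cite: Lazard1955, §II (bourgeons)] -/
theorem BTGroup.exists_formalOModuleLaw_of_coordinates (hp : 2 ≤ p) (hH : 0 < H)
    (hnat : ∀ (n : ℕ) (R R' : Type u) [CommRing R] [Algebra k R] [CommRing R'] [Algebra k R'] (φ : R →ₐ[k] R')
      (g : specOver (A := k) R' ⟶ specOver (A := k) R), g.left = Spec.map (CommRingCat.ofHom φ.toRingHom) →
      ∀ f : specOver (A := k) R ⟶ B.G n, ((c n R') (g ≫ f)).1 = φ ((c n R) f).1)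
    (hincl : ∀ (n : ℕ) (R : Type u) [CommRing R] [Algebra k R] (f : specOver (A := k) R ⟶ B.G n),
      ((c (n + 1) R) (f ≫ B.incl n)).1 = ((c n R) f).1)
    {𝒪 : Type v} [CommRing 𝒪] (β : 𝒪 → BTGroup.Hom B B) (hβ : IsRingActionBT B β) :
    ∃ χ : 𝒪 →+* k,
      letI := χ.toAlgebra
      ∃ M : FormalOModuleLaw 𝒪 k,
        (∀ (n : ℕ) (R : Type u) [CommRing R] [Algebra k R] (f g : specOver (A := k) R ⟶ B.G n),
          letI := B.grpObj n; ((c n R) (f * g)).1 = evalNilp₂ M.toFormalGroup.toPowerSeries ((c n R) f).1 ((c n R) g).1) ∧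
        (∀ (a : 𝒪) (n : ℕ) (R : Type u) [CommRing R] [Algebra k R] (f : specOver (A := k) R ⟶ B.G n),
          ((c n R) (f ≫ (β a).app n)).1 = evalNilp (M.act a).toPowerSeries ((c n R) f).1) := by
  -- §a the series of every layer (★ P1)
  have hPex : ∀ n, ∃ P : MvPowerSeries (Fin 2) k, ∀ (R : Type u) [CommRing R] [Algebra k R]
      (f f' : specOver (A := k) R ⟶ B.G n),
      letI := B.grpObj n; ((c n R) (f * f')).1 = evalNilp₂ P ((c n R) f).1 ((c n R) f').1 := fun n => by
    letI := B.grpObj n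
    exact exists_series_of_mul (c n) (hnat n)
  choose P hP using hPex
  have hρex : ∀ (n : ℕ) (a : 𝒪), ∃ ρ : PowerSeries k, ∀ (R : Type u) [CommRing R] [Algebra k R]
      (f : specOver (A := k) R ⟶ B.G n), ((c n R) (f ≫ (β a).app n)).1 = evalNilp ρ ((c n R) f).1 := fun n a => by
    letI := B.grpObj n
    exact exists_series_of_endomorphism (c n) (hnat n) ((β a).app n)
  choose ρ hρ using hρex
  have h1 : ∀ (n : ℕ) (R : Type u) [CommRing R] [Algebra k R],
      letI := B.grpObj n; ((c n R) (1 : specOver (A := k) R ⟶ B.G n)).1 = 0 := fun n R _ _ => by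
    letI := B.grpObj n
    exact coord_one_eq_zero (c n) (hnat n) R
  -- §b the bud axioms of every layer (★ P2, ★ P3) and the tower compatibilities (★ P1)
  obtain ⟨hN1, hN⟩ := box_sizes (p := p) (H := H) hp hH
  have hP0 : ∀ n, MvPowerSeries.constantCoeff (P n) = 0 := fun n => by
    letI := B.grpObj n
    exact constantCoeff_law_eq_zero (c n) (hP n) (h1 n)
  have hP2 : ∀ n, 2 ≤ p ^ (n * H) →
      ((2 : ℕ) : ℕ∞) ≤ (P n - MvPowerSeries.X 0 - MvPowerSeries.X 1).order := fun n h2 => by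
    letI := B.grpObj n
    exact two_le_order_law_sub (c n) (hP n) (h1 n) h2
  have hu1 : ∀ (a : 𝒪) (n : ℕ) (R : Type u) [CommRing R] [Algebra k R],
      letI := B.grpObj n; (1 : specOver (A := k) R ⟶ B.G n) ≫ (β a).app n = 1 := fun a n R _ _ => by
    letI := B.grpObj n
    haveI := (β a).isMonHom_app n
    exact MonObj.one_comp _
  have hρ0 : ∀ n a, PowerSeries.constantCoeff (ρ n a) = 0 := fun n a => by
    letI := B.grpObj n
    exact constantCoeff_endo_eq_zero (c n) (h1 n) (hu1 a n) (hρ n a)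
  have hassoc : ∀ n, ((p ^ (n * H) : ℕ) : ℕ∞) ≤ (assocDefect (P n)).order := fun n => by
    letI := B.grpObj n
    exact natCast_le_order_assocDefect (c n) (hP0 n) (hP n)
  have hcomm : ∀ n, ((p ^ (n * H) : ℕ) : ℕ∞) ≤ (commDefect (P n)).order := fun n => by
    letI := B.grpObj n
    letI := B.comm n
    exact natCast_le_order_commDefect (c n) (hP n)
  have hhom : ∀ n a, ((p ^ (n * H) : ℕ) : ℕ∞) ≤ (homDefect (P n) (ρ n a)).order := fun n a => by
    letI := B.grpObj n
    haveI := (β a).isMonHom_app n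
    exact natCast_le_order_homDefect (c n) (hP n) (h1 n) ((β a).app n) (hρ n a)
  have hadd : ∀ n a b, ((p ^ (n * H) : ℕ) : ℕ∞) ≤
      MvPowerSeries.order (addDefect (P n) (ρ n a) (ρ n b) (ρ n (a + b))) := fun n a b => by
    letI := B.grpObj n
    refine natCast_le_order_addDefect (c n) (hP n) (h1 n) (u := (β a).app n) (v := (β b).app n)
      (w := (β (a + b)).app n) (fun R _ _ f => ?_) (hu1 a n) (hu1 b n) (hρ n a) (hρ n b) (hρ n (a + b))
    rw [hβ.app_add' a b n, MonObj.comp_mul]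
  have hmul : ∀ n a b, ((p ^ (n * H) : ℕ) : ℕ∞) ≤
      MvPowerSeries.order (mulDefect (ρ n a) (ρ n b) (ρ n (a * b))) := fun n a b => by
    letI := B.grpObj n
    refine natCast_le_order_mulDefect (c n) (h1 n) (u := (β a).app n) (v := (β b).app n)
      (w := (β (a * b)).app n) (by rw [hβ.map_mul a b]; rfl) (hu1 b n) (hρ n a) (hρ n b) (hρ n (a * b))
  have hone : ∀ n, ((p ^ (n * H) : ℕ) : ℕ∞) ≤ MvPowerSeries.order (ρ n 1 - PowerSeries.X) := fun n => by
    letI := B.grpObj n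
    refine natCast_le_order_endo_id (c n) fun R _ _ f => ?_
    rw [← hβ.app_one n]
    exact hρ n 1 R f
  have hzero : ∀ n, ((p ^ (n * H) : ℕ) : ℕ∞) ≤ MvPowerSeries.order (ρ n 0) := fun n => by
    letI := B.grpObj n
    refine natCast_le_order_endo_one (c n) (h1 n) (u := (β 0).app n) (fun R _ _ f => ?_) (hρ n 0)
    rw [hβ.app_zero n]
    exact MonObj.comp_one f
  have htP : ∀ n (d : Fin 2 →₀ ℕ), d 0 < p ^ (n * H) → d 1 < p ^ (n * H) →
      MvPowerSeries.coeff d (P (n + 1)) = MvPowerSeries.coeff d (P n) := fun n d hd0 hd1 => by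
    letI := B.grpObj n
    letI := B.grpObj (n + 1)
    haveI := B.incl_isMonHom n
    exact (coeff_law_eq_of_hom (c n) (c (n + 1)) (B.incl n) (hincl n) (hP n) (hP (n + 1)) hd0 hd1).symm
  have htρ : ∀ n a i, i < p ^ (n * H) →
      PowerSeries.coeff i (ρ (n + 1) a) = PowerSeries.coeff i (ρ n a) := fun n a i hi => by
    letI := B.grpObj n
    letI := B.grpObj (n + 1)
    exact (coeff_endo_eq_of_hom (c n) (c (n + 1)) (B.incl n) (hincl n) ((β a).app n) ((β a).app (n + 1))
      ((β a).incl_comp_app n).symm (hρ n a) (hρ (n + 1) a) hi).symm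
  -- §c the tangent character and the limit law (P4a)
  obtain ⟨χ, -, M, hMP, hMρ⟩ := exists_formalOModuleLaw_of_tower (𝒪 := 𝒪) (fun n => p ^ (n * H)) hN1 hN P ρ hP0 hP2 hρ0
    hassoc hcomm hhom hadd hmul hone hzero htP htρ
  refine ⟨χ, M, fun n R _ _ f g => ?_, fun a n R _ _ f => ?_⟩
  · rw [hP n R f g]
    exact evalNilp₂_congr_of_coeff_box_eq (fun d hd0 hd1 => (hMP n d hd0 hd1).symm) ((c n R) f).2 ((c n R) g).2
  · rw [hρ n a R f]
    exact evalNilp_congr_of_coeff_eq (fun i hi => (hMρ n a i hi).symm) ((c n R) f).2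

end Law

end Literature.AlgebraicGeometry.GroupSchemes
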